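/-
Copyright (c) 2026 the pub-hodgecm-mathlib formalisation cell (harness21).  Prover seat hodgecm-mathlib-K2E4-p11 (g6), Track B ∕ K2-LIT, h413 =
`stmt-HodgeConjecture-24833`, line `K2_E1_TraceFormulaBeta`, campaign «5Res (c) MS-2(χ,τ)», TABLE 13th issue §F row 15 (dealer K2E1-plan (g6) deal (125)
2026-09-04T11:18:40Z): the (χ,τ)-PRINT of ★ p859643 CLOSER₂ `K2E1MaassSelbergFamilyCMTwo` in BINDER form — the `L²(𝔛, μ)`-holomorphic family of truncated continued
Eisenstein series `z ↦ [Λ^{T₀} E(φ, z)]` of `U(1,1)_{L∕L⁺}` for a section `φ` of a finite-dimensional section space `V` on which the test functions act through Hecke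
MATRICES `𝔥_j(z) ∈ End V` (★ p859566), assembled from the SECTION-FREE operator road ★ p859533 ∕ p859522 ∕ p859585 ∕ p859427 — PURE ASSEMBLY.
-/
import Summits.HodgeConjecture.HodgeConjecture.Theorems.K2E1MaassSelbergFamilyCMTwo   -- ★ p859643 CLOSER₂ (K2E1-p11): §0 glue `exists_differentiableOn_of_local_ae_eq_within`; brings ★ X1, ★ natural payer p859522, ★ (O2c) p859533, ★ `hid_of_unfolding` p859585, ★ lift brick, every CM input
import HarnessLib

/-!
# h413 ∕ Track B «K2-LIT», «MS-2(χ,τ)» — `K2E1ChiMaassSelbergFamilyCMTwo`: the (χ,τ)-PRINT OF CLOSER₂ — the `L²(𝔛)`-holomorphic family `z ↦ [Λ^{T₀} Ẽ(φ, z)]` of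
# `U(1,1)_{L∕L⁺}` on `U ∖ P`, for a section `φ ∈ V` with the test functions acting on `V` through the Hecke matrices `𝔥_j(z)`

Cell `pub/hodgecm-mathlib`, crux H413 = `stmt-HodgeConjecture-24833`, route `HCCMUnconditional`; TABLE 13th issue §F row 15, dealer K2E1-plan (g6) deal (125).  THEOREMS ONLY
(no `def` ∕ `instance` ∕ `notation` ∕ named-fact hypothesis ∕ `sorry`; default heartbeats); lane `--kind proof --supports stmt-HodgeConjecture-24833 --as helper` (count-neutral; closes
no socket).

WHAT CHANGES WITH `(χ, τ)` ([MoeglinWaldspurger1995, I.2.17, II.1.7, IV.2.3]; [BernsteinLapid2019, §4 Claim 1 and p. 10]).  In ★ CLOSER₂ `exists_truncatedFamily_cm_two` the spherical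
section is rigid: the test function `h_j` acts on the flat section `φ₀H^z` by the SCALAR `ĥ_j(z)`, the patches of the holomorphy set are `V_j = U ∩ {ĥ_j ≠ 0}` and the pointwise
representation (E5) reads `Ẽ(z)(g) = ĥ_j(z)⁻¹ · ∫ h_j(y)·vX(z)[(g y)⁻¹] dν_G(y)`.  For a cuspidal datum `(χ, τ)` the sections form a finite-dimensional space `V` (★ p859551
`chiSectionSpace χ K′ ω`), a `K′`-central test function `h_j` acts on the flat sections `f_z^φ`, `φ ∈ V`, through the Hecke MATRIX `𝔥_j(z) ∈ Module.End ℂ V` (★ p859566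
`exists_heckeEnd_cm`: `R(h_j) f_z^φ = f_z^{𝔥_j(z)φ}`, entrywise entire), the unknown of the Bernstein–Lapid `𝔛`-system is a LINEAR MAP `Ψ(z) : V →ₗ 𝔛` (dealer ruling (119)), the
patches are `V_j = U ∩ {z | 𝔥_j(z) invertible}` and (E5) becomes `Ẽ(φ, z)(g) = ∫ h_j(y)·Ψ(z)(𝔥_j(z)⁻¹ φ)[(g y)⁻¹] dν_G(y)` (from `R(h_j) E(f_z^{ψ}) = E(f_z^{𝔥_j(z)ψ})` at
`ψ = 𝔥_j(z)⁻¹φ`).  NOTHING ELSE CHANGES: the operator road — the low cut-off `A_T` (★ (O1) `exists_lowPart_clm`), the high part `K_j = M ∘L K_Z` (★ (O2c) `exists_highPartOperator_two`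
with ★ `hid_of_unfolding`), the a.e. identity `[Λ^T Ẽ(z)] = A_T(T_j s_j(z)) + K_j(s_j(z))` of the natural payer ★ `exists_family_of_operator_letters'` — is SECTION-FREE: it sees only
the `𝔛`-valued holomorphic map `s_j(z)` that represents `Ẽ(z)` on the patch.  So this file first proves the PATCH form of closer₂ (§1: open patches `W_j` covering `U`, holomorphic
`s_j : U ∩ W_j → 𝔛`, (E5) without prefactor), then reads the (χ,τ) currency into it (§2: `W_j = {IsUnit (𝔥_j z)}`, `s_j(z) = Ψ(z)(Ring.inverse (𝔥_j z) φ)`), with the two regularity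
facts the spherical case got for free from ★ `differentiable_integral_mul_borelHeight_cpow` — openness of `{z | IsUnit (𝔥_j z)}` and holomorphy of `z ↦ Ψ(z)(𝔥_j(z)⁻¹ φ)` — as
binders `h𝔥o`, `hΨ` (both are finite-dimensional linear algebra over the entrywise holomorphy of ★ p859566: determinant and adjugate of the matrix of `𝔥_j(z)`; discharged in the
companion file `K2E1ChiHeckeMatrixInverseHolomorphicU2`).  The consumer is ★ row 14 FILE 2 `K2E1ChiMaassSelbergContinuedCMTwo.poleControl_continued_chi_cm_two_of_truncatedFamily_on`
(K2E1-p15): its `(F, hFd)` on `D₁ := (D⁺ ∩ D_n ∩ U) ∖ P`, `D⁺ = {½ < Re z, 0 < Im z}` (§2 `_upper`), `hFtube` following from (E1) `Ẽ(φ, z) = E(f_z^φ)` on the tube `1 < Re z`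
(★ X2_χ).
CURRENCIES.  ★ 12b ED. 1 `K2E1ChiEisensteinMeromorphicBallU2` (K2E1-p10) keeps, for each FIXED `φ ∈ V`, a VECTOR unknown `eX : ℂ → 𝔛` and the SCALAR Hecke clause of the 12c road
(arch-only test functions act on `V` by scalars, ruling (119)(3)): in that currency ★ CLOSER₂ `exists_truncatedFamily_cm_two` applies VERBATIM (`vX := eX`), and §1 below with
`W_j := {ĥ_j ≠ 0}`, `s_j := ĥ_j⁻¹ • eX`; the Hom-valued ∕ matrix currency of rulings (118)–(119) (`Ψ(z) : V →ₗ 𝔛`, cover by `IsUnit (𝔥_j z)`) is §2.  §1 is the common socket.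
* §1 **`exists_truncatedFamily_cm_two_of_patches`** — CLOSER₂ IN PATCH FORM (section-free: open patches `W_j`, holomorphic `s_j`, cover of `U`, (E5) `Ẽ(z)(g) = ∫ h_j(y)·s_j(z)[(g y)⁻¹]`).
* §2 **`exists_truncatedFamily_chi_cm_two`** — THE (χ,τ) HEAD on `U ∖ P` (matrix currency); **`exists_truncatedFamily_chi_cm_two_upper`** — its print on `D₁ = ({½ < Re, 0 < Im} ∩ D_n ∩ U) ∖ P`.
HONEST LABEL.  Count-neutral helper; proves no printed statement; letter-free except the X1_χ∕X2_χ binders it is fed (`h𝔥o`, `hΨ`, (E5)); HC_CM is proved only modulo the 7 printed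
citations (2 remaining named inputs: hLiu418 = `stmt-HodgeConjecture-24832`, h413 = `stmt-HodgeConjecture-24833`) until rung 0 closes.

## References
* [BernsteinLapid2019] J. Bernstein, E. Lapid, *On the meromorphic continuation of Eisenstein series*, J. AMS 37 (2024) (arXiv:1911.02342), Thm 2.3, §4 Claim 1 (p. 9), Claims 4–5 (p. 10).
* [MoeglinWaldspurger1995] C. Mœglin, J.-L. Waldspurger, *Spectral decomposition and Eisenstein series* (1995), I.2.13, I.2.17, II.1.7, IV.2.3, IV.3.12 (a).
-/

set_option autoImplicit false
-- the mandated namespace repeats `HodgeConjecture.HodgeConjecture`, as in every `Theorems/*.lean` of this sub-problem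
set_option linter.dupNamespace false

noncomputable section

open MeasureTheory MeasureTheory.Measure Set NumberField IsDedekindDomain Filter Topology
open scoped NNReal ENNReal ComplexConjugate
open Literature.MeasureTheory.Group Literature.NumberTheory
open Literature.NumberTheory.Automorphic Literature.NumberTheory.Automorphic.UnitaryGroup AdelicGroupData
open Summit.HodgeConjecture.HodgeConjecture.Cruxes.H413.K2E1BLBorelSpacesU2Defs
open Summit.HodgeConjecture.HodgeConjecture.Cruxes.H413.K2E1BLBorelOperatorsU2Defs
open Summit.HodgeConjecture.HodgeConjecture.Cruxes.H413.K2E1BLIotaClosedEmbeddingU2 (iotaBound_cm isFiniteMeasure_weightedTruncMeasure_cm)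
open Summit.HodgeConjecture.HodgeConjecture.Cruxes.H413.K2E1BLQuotientMeasureU (measurePreserving_rightShift_of_unfolding)
open Summit.HodgeConjecture.HodgeConjecture.Cruxes.H413.K2E1BLShiftBoundU2 (shiftBound_of_isCompact)
open Summit.HodgeConjecture.HodgeConjecture.Cruxes.H413.K2E1IntertwinedSectionInvariance (map_conj_toAdelic_eq_self_two)
open Summit.HodgeConjecture.HodgeConjecture.Cruxes.H413.K2E1MaassSelbergFamilyPayerCMTwo (exists_lowPart_clm)
open Summit.HodgeConjecture.HodgeConjecture.Cruxes.H413.K2E1MaassSelbergFamilyPayerNaturalCMTwo (exists_family_of_operator_letters')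
open Summit.HodgeConjecture.HodgeConjecture.Cruxes.H413.K2E1BLHighPartOperatorU (exists_highPartOperator_two)
open Summit.HodgeConjecture.HodgeConjecture.Cruxes.H413.K2E1BLHighPartIdentificationU (hid_of_unfolding)
open Summit.HodgeConjecture.HodgeConjecture.Cruxes.H413.K2E1BLLiftIntegrabilityU (lift_quotientSubgroup_mul)
open Summit.HodgeConjecture.HodgeConjecture.Cruxes.H413.K2E1MaassSelbergFamilyCMTwo (exists_differentiableOn_of_local_ae_eq_within)

namespace Summit.HodgeConjecture.HodgeConjecture.Cruxes.H413.K2E1ChiMaassSelbergFamilyCMTwo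

section Closer

variable (L : Type) [Field L] [NumberField L] [IsCMField L]
  [MeasurableSpace (quasiSplit (↥(maximalRealSubfield L)) L (IsCMField.complexConj L) 2).Adelic] [BorelSpace (quasiSplit (↥(maximalRealSubfield L)) L (IsCMField.complexConj L) 2).Adelic]

/-! ## §1 CLOSER₂ IN PATCH FORM (section-free) -/

/-- **CLOSER₂ IN PATCH FORM — SECTION-FREE.**  Structural letters and the per-ball objects `η, h = S_η η, a, κ, T, U` with their clauses exactly as ★ `exists_truncatedFamily_cm_two`
(the cusp-decay ∕ high-part ∕ low-part machinery sees only them); the spherical data `(vX, ĥ_j)` replaced by OPEN PATCHES `W_j` covering `U`, `𝔛`-valued maps `s_j` HOLOMORPHIC ON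
`U ∩ W_j`, a global continued function `Ec`, a set `P`, and the pointwise representation (E5) `Ec z g = ∫ h_j(y)·s_j(z)[(g y)⁻¹] dν_G(y)` for `z ∈ (U ∩ W_j) ∖ P`.  THEN
`∃ T₀ ≥ 1, ∃ Fam, DifferentiableOn ℂ Fam (U ∖ P) ∧ ∀ z ∈ U ∖ P, Fam z =ᵐ[μ] quotFun (Λ^{T₀} (Ec z))`.  (Spherical case: `W_j = {ĥ_j ≠ 0}`, `s_j = ĥ_j⁻¹ • vX`; (χ,τ): §2.)
[cite: BernsteinLapid2019, Thm 2.3 and §4 Claims 4–5 (p. 10)] [cite: MoeglinWaldspurger1995, I.2.13, IV.2.3] -/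
theorem exists_truncatedFamily_cm_two_of_patches
    -- structural letters: the measures (as ★ X1 ∕ ★ CLOSER₂)
    (μ : Measure (quasiSplit (↥(maximalRealSubfield L)) L (IsCMField.complexConj L) 2).automorphicQuotient) [(quasiSplit (↥(maximalRealSubfield L)) L (IsCMField.complexConj L) 2).IsAutomorphicMeasure μ]
    (νG : Measure (quasiSplit (↥(maximalRealSubfield L)) L (IsCMField.complexConj L) 2).Adelic) [νG.IsHaarMeasure] [νG.IsInvInvariant] [SFinite νG]
    (ν : Measure ↥(adelicUnipotent (↥(maximalRealSubfield L)) L (IsCMField.complexConj L) 2)) [ν.IsHaarMeasure] [ν.IsMulRightInvariant] [ν.IsInvInvariant]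
    {𝓕 : Set ↥(adelicUnipotent (↥(maximalRealSubfield L)) L (IsCMField.complexConj L) 2)}
    (h𝓕N : IsFundamentalDomain ↥(rationalUnipotent (↥(maximalRealSubfield L)) L (IsCMField.complexConj L) 2) 𝓕 ν) (h𝓕c : IsCompact (closure 𝓕)) (h𝓕₀ : ν 𝓕 ≠ 0)
    {β : (quasiSplit (↥(maximalRealSubfield L)) L (IsCMField.complexConj L) 2).Adelic → ℝ≥0∞}
    (hβ : IsCoveringWeight ↥((arithmeticBorel (↥(maximalRealSubfield L)) L (IsCMField.complexConj L) 2).map (quasiSplit (↥(maximalRealSubfield L)) L (IsCMField.complexConj L) 2).arithmeticSubgroup.subtype) β)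
    {μZ : Measure (borelQuotient (↥(maximalRealSubfield L)) L (IsCMField.complexConj L) 2)} [SFinite μZ]
    (hμZ : ∀ f : borelQuotient (↥(maximalRealSubfield L)) L (IsCMField.complexConj L) 2 → ℝ≥0∞, Measurable f → ∫⁻ z, f z ∂μZ = ∫⁻ g, β g * f (toBorelQuotient (↥(maximalRealSubfield L)) L (IsCMField.complexConj L) 2 g) ∂νG)
    -- per-ball objects (weight `k = n + 3`): test functions, levels, convolution operators, the holomorphy set
    (n : ℕ) {I : Type} [Fintype I] (η : I → GL (Fin 2) (AdeleRing (𝓞 L) L) → ℝ) (h : I → (quasiSplit (↥(maximalRealSubfield L)) L (IsCMField.complexConj L) 2).Adelic → ℂ) (a : ℝ≥0) (κ : I → ℝ≥0)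
    (T : I → HX (↥(maximalRealSubfield L)) L (IsCMField.complexConj L) 2 (n + 3) μ →L[ℂ] HX (↥(maximalRealSubfield L)) L (IsCMField.complexConj L) 2 (n + 3) μ) (U : Set ℂ)
    -- the patches: open sets `W_j` and `𝔛`-valued maps `s_j`
    (W : I → Set ℂ) (s : I → ℂ → HX (↥(maximalRealSubfield L)) L (IsCMField.complexConj L) 2 (n + 3) μ)
    -- clauses (only those used)
    (hη : ∀ i, IsTestFunctionGL 2 L (η i))
    (hdef : ∀ i, h i = fun y : (quasiSplit (↥(maximalRealSubfield L)) L (IsCMField.complexConj L) 2).Adelic => orbitalSmoothing νG (fun x : (quasiSplit (↥(maximalRealSubfield L)) L (IsCMField.complexConj L) 2).Adelic => ((η i (adelicVal (↥(maximalRealSubfield L)) L (IsCMField.complexConj L) 2 ((StdForm.antidiagonal 2).over L) x) : ℝ) : ℂ)) (fun x : (quasiSplit (↥(maximalRealSubfield L)) L (IsCMField.complexConj L) 2).Adelic => ((η i (adelicVal (↥(maximalRealSubfield L)) L (IsCMField.complexConj L) 2 ((StdForm.antidiagonal 2).over L) x) : ℝ) : ℂ)) y)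
    (hreg : ∀ i, Continuous (h i) ∧ HasCompactSupport (h i))
    (ha : 0 < a) (hκ : ∀ i, 1 ≤ κ i)
    (hΩ : ∀ i, ∀ z : borelQuotient (↥(maximalRealSubfield L)) L (IsCMField.complexConj L) 2, ∀ y ∈ tsupport (h i), borelQuotHeight (↥(maximalRealSubfield L)) L (IsCMField.complexConj L) 2 z ≤ κ i * borelQuotHeight (↥(maximalRealSubfield L)) L (IsCMField.complexConj L) 2 (rightShift (↥(maximalRealSubfield L)) L (IsCMField.complexConj L) 2 y z))
    (hTX : ∀ i, ∀ u : HX (↥(maximalRealSubfield L)) L (IsCMField.complexConj L) 2 (n + 3) μ, (T i u : (quasiSplit (↥(maximalRealSubfield L)) L (IsCMField.complexConj L) 2).automorphicQuotient → ℂ) =ᵐ[μ.withDensity fun x => (((supHeight (↥(maximalRealSubfield L)) L (IsCMField.complexConj L) 2 x)⁻¹ ^ (2 * (n + 3)) : ℝ≥0) : ℝ≥0∞)]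
      fun ξ => ∫ y, h i y * (u : (quasiSplit (↥(maximalRealSubfield L)) L (IsCMField.complexConj L) 2).automorphicQuotient → ℂ) (y⁻¹ • ξ) ∂νG)
    (hUo : IsOpen U) (hWo : ∀ i, IsOpen (W i)) (hcov : ∀ z ∈ U, ∃ i, z ∈ W i) (hs : ∀ i, DifferentiableOn ℂ (s i) (U ∩ W i))
    -- the global continued function, the exceptional set, and the pointwise representation (E5) on the patches
    (Ec : ℂ → (quasiSplit (↥(maximalRealSubfield L)) L (IsCMField.complexConj L) 2).Adelic → ℂ) (P : Set ℂ)
    (hE5 : ∀ j, ∀ z ∈ U ∩ W j, z ∉ P → ∀ g : (quasiSplit (↥(maximalRealSubfield L)) L (IsCMField.complexConj L) 2).Adelic,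
      Ec z g = ∫ y, h j y * ((s j z : HX (↥(maximalRealSubfield L)) L (IsCMField.complexConj L) 2 (n + 3) μ) : (quasiSplit (↥(maximalRealSubfield L)) L (IsCMField.complexConj L) 2).automorphicQuotient → ℂ)
          ((quasiSplit (↥(maximalRealSubfield L)) L (IsCMField.complexConj L) 2).toAutomorphicQuotient (g * y)⁻¹) ∂νG) :
    ∃ T₀ : ℝ≥0, 1 ≤ T₀ ∧ ∃ Fam : ℂ → Lp ℂ 2 μ, DifferentiableOn ℂ Fam (U \ P) ∧
      ∀ z ∈ U \ P, ((Fam z : Lp ℂ 2 μ) : (quasiSplit (↥(maximalRealSubfield L)) L (IsCMField.complexConj L) 2).automorphicQuotient → ℂ) =ᵐ[μ]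
        (quasiSplit (↥(maximalRealSubfield L)) L (IsCMField.complexConj L) 2).quotFun (truncation ν 𝓕 T₀ (Ec z)) := by
  classical
  -- involution facts, structural consequences
  have hc : IsCMField.complexConj L * IsCMField.complexConj L = 1 :=
    AlgEquiv.ext fun x => by rw [AlgEquiv.mul_apply, AlgEquiv.one_apply, IsCMField.complexConj_apply_apply]
  have hc1 : IsCMField.complexConj L ≠ 1 := IsCMField.complexConj_ne_one L
  have h𝓕top : ν 𝓕 ≠ ∞ := ((measure_mono subset_closure).trans_lt h𝓕c.measure_lt_top).ne
  haveI : νG.IsMulRightInvariant := by rw [← Measure.inv_eq_self νG]; infer_instance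
  have hright := measurePreserving_rightShift_of_unfolding νG hβ hμZ
  letI : MeasurableSpace (AdeleRing (𝓞 L) L) := borel _
  haveI : BorelSpace (AdeleRing (𝓞 L) L) := ⟨rfl⟩
  have hconj := fun b₀ (hb₀ : b₀ ∈ borelU (IsCMField.complexConj L : L →+* L) ((StdForm.antidiagonal 2).over L)) => map_conj_toAdelic_eq_self_two hc hc1 ν hb₀
  -- the test functions: `h = S_η η`, continuity, compact support
  have hfun : h = fun i => fun y : (quasiSplit (↥(maximalRealSubfield L)) L (IsCMField.complexConj L) 2).Adelic => orbitalSmoothing νG (fun x : (quasiSplit (↥(maximalRealSubfield L)) L (IsCMField.complexConj L) 2).Adelic => ((η i (adelicVal (↥(maximalRealSubfield L)) L (IsCMField.complexConj L) 2 ((StdForm.antidiagonal 2).over L) x) : ℝ) : ℂ)) (fun x : (quasiSplit (↥(maximalRealSubfield L)) L (IsCMField.complexConj L) 2).Adelic => ((η i (adelicVal (↥(maximalRealSubfield L)) L (IsCMField.complexConj L) 2 ((StdForm.antidiagonal 2).over L) x) : ℝ) : ℂ)) y :=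
    funext hdef
  have hhc : ∀ i, Continuous (h i) := fun i => (hreg i).1
  have hhs : ∀ i, HasCompactSupport (h i) := fun i => (hreg i).2
  -- levels: the pull-back letter at `a`, the shift constants `κ'_j`, and ONE common upper level `T₀`
  have hb : IotaBound (↥(maximalRealSubfield L)) L (IsCMField.complexConj L) 2 (n + 3) a μ μZ := iotaBound_cm L μ νG hβ hμZ ha (n + 3)
  haveI : IsFiniteMeasure (weightedTruncMeasure (↥(maximalRealSubfield L)) L (IsCMField.complexConj L) 2 (n + 3) a μZ) := isFiniteMeasure_weightedTruncMeasure_cm L μ νG hβ hμZ ha (n + 3)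
  have hSB : ∀ j, ∃ κ' : ℝ≥0, 1 ≤ κ' ∧ ∀ (k : ℕ) (c₁ c₀ : ℝ≥0), κ' * c₁ ≤ c₀ →
      ∀ h' : (quasiSplit (↥(maximalRealSubfield L)) L (IsCMField.complexConj L) 2).Adelic → ℂ, Measurable h' → Integrable h' νG → (∀ y, y ∉ tsupport (h j) → h' y = 0) →
        ShiftBound (↥(maximalRealSubfield L)) L (IsCMField.complexConj L) 2 k c₁ c₀ νG μZ h' := fun j =>
    shiftBound_of_isCompact (νG := νG) (μZ := μZ) hright (hhs j).isCompact
  choose κ' hκ'1 hκ' using hSB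
  set T₀ : ℝ≥0 := max 1 (Finset.univ.sup fun j => max (κ' j) (κ j) * a) with hT₀def
  have hT₀1 : 1 ≤ T₀ := le_max_left _ _
  have hT₀pos : 0 < T₀ := lt_of_lt_of_le one_pos hT₀1
  have hκT : ∀ j, κ j * a ≤ T₀ := fun j =>
    ((mul_le_mul_of_nonneg_right (le_max_right (κ' j) (κ j)) zero_le).trans (Finset.le_sup (f := fun j => max (κ' j) (κ j) * a) (Finset.mem_univ j))).trans (le_max_right _ _)
  have hκ'T : ∀ j, κ' j * a ≤ T₀ := fun j =>
    ((mul_le_mul_of_nonneg_right (le_max_left (κ' j) (κ j)) zero_le).trans (Finset.le_sup (f := fun j => max (κ' j) (κ j) * a) (Finset.mem_univ j))).trans (le_max_right _ _)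
  haveI : IsFiniteMeasure (weightedTruncMeasure (↥(maximalRealSubfield L)) L (IsCMField.complexConj L) 2 0 T₀ μZ) := isFiniteMeasure_weightedTruncMeasure_cm L μ νG hβ hμZ hT₀pos 0
  -- the shift letters at `(a, T₀)`
  have hsh : ∀ j, ShiftBound (↥(maximalRealSubfield L)) L (IsCMField.complexConj L) 2 (n + 3) a T₀ νG μZ (h j) := fun j =>
    hκ' j (n + 3) a T₀ (hκ'T j) (h j) (hhc j).measurable ((hhc j).integrable_of_hasCompactSupport (hhs j)) fun y hy => image_eq_zero_of_notMem_tsupport hy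
  -- K2's cusp decay at `(a, T₀)` for `h_j = S_{η_j} η_j` (★ `hK1_cm_two_of` ∘ ★ K2-defs1 (ii) ∘ ★ product formula), `m = 0`
  have hK1 : ∀ j, ∃ C : ℝ, 0 ≤ C ∧ ∀ f : HNcusp (↥(maximalRealSubfield L)) L (IsCMField.complexConj L) 2 (n + 3) a μZ,
      ∀ᵐ z ∂(weightedTruncMeasure (↥(maximalRealSubfield L)) L (IsCMField.complexConj L) 2 (n + 3) T₀ μZ),
        ‖rightConvFun (↥(maximalRealSubfield L)) L (IsCMField.complexConj L) 2 νG (h j) ((f : HN (↥(maximalRealSubfield L)) L (IsCMField.complexConj L) 2 (n + 3) a μZ) : borelQuotient (↥(maximalRealSubfield L)) L (IsCMField.complexConj L) 2 → ℂ) z‖ ≤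
          C * ‖f‖ * ((borelQuotHeight (↥(maximalRealSubfield L)) L (IsCMField.complexConj L) 2 z : ℝ)) ^ (-(0 : ℝ)) := by
    intro j
    subst hfun
    exact K2E1TruncatedCuspDecayHK1CMTwo.hK1_cm_two_of L μZ νG hβ hμZ (hη j) (n + 3) a T₀ hT₀pos
      (fun νN _ _ _ 𝓕N h𝓕 h0 htop f => K2E1TruncatedCuspConstantTermAEU2.ae_borelConstantTerm_indicator_comp_eq_zero_of_mem_HNcusp νG νN
        (fun _ hb₀ => map_conj_toAdelic_eq_self_two hc hc1 νN hb₀) h𝓕 h0 htop hβ hμZ (n + 3) a f)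
      (lt_of_lt_of_le zero_lt_one (hκ j)) (hκT j) (hΩ j) (m := 0) le_rfl
  choose C hC hK1' using hK1
  -- the high-part operators `K_j` ((O2c) ★ with `hid` ★), the low cut-off `A` ((O1) ★)
  have hK : ∀ j, ∃ K : HX (↥(maximalRealSubfield L)) L (IsCMField.complexConj L) 2 (n + 3) μ →L[ℂ] Lp ℂ 2 μ, ∀ u : HX (↥(maximalRealSubfield L)) L (IsCMField.complexConj L) 2 (n + 3) μ, ∀ᵐ x ∂μ,
      (supHeight (↥(maximalRealSubfield L)) L (IsCMField.complexConj L) 2 x ≤ T₀ → ((K u : Lp ℂ 2 μ) : (quasiSplit (↥(maximalRealSubfield L)) L (IsCMField.complexConj L) 2).automorphicQuotient → ℂ) x = 0) ∧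
      ∀ g : (quasiSplit (↥(maximalRealSubfield L)) L (IsCMField.complexConj L) 2).Adelic, (quasiSplit (↥(maximalRealSubfield L)) L (IsCMField.complexConj L) 2).toAutomorphicQuotient g⁻¹ = x → T₀ < borelHeight g →
        ((K u : Lp ℂ 2 μ) : (quasiSplit (↥(maximalRealSubfield L)) L (IsCMField.complexConj L) 2).automorphicQuotient → ℂ) x =
          (∫ y, h j y * (u : (quasiSplit (↥(maximalRealSubfield L)) L (IsCMField.complexConj L) 2).automorphicQuotient → ℂ) ((quasiSplit (↥(maximalRealSubfield L)) L (IsCMField.complexConj L) 2).toAutomorphicQuotient (g * y)⁻¹) ∂νG) -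
            borelConstantTerm ν 𝓕 (fun x' => ∫ y, h j y * (u : (quasiSplit (↥(maximalRealSubfield L)) L (IsCMField.complexConj L) 2).automorphicQuotient → ℂ) ((quasiSplit (↥(maximalRealSubfield L)) L (IsCMField.complexConj L) 2).toAutomorphicQuotient (x' * y)⁻¹) ∂νG) g := fun j =>
    exists_highPartOperator_two μ νG hβ hμZ hT₀1 hb (hsh j) (hC j) le_rfl (hK1' j) le_rfl ν 𝓕
      fun u => hid_of_unfolding νG ν hconj h𝓕N h𝓕₀ h𝓕top hβ hμZ μ h𝓕c hb (hhc j) (hhs j) (lt_of_lt_of_le zero_lt_one (hκ j)) (hκT j) (hΩ j) (hsh j) le_rfl u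
  choose K hKspec using hK
  obtain ⟨A, hA, -⟩ := exists_lowPart_clm (F := ↥(maximalRealSubfield L)) (E := L) (c := IsCMField.complexConj L) (N := 2) (n + 3) T₀ μ
  -- the family on `U ∖ P`, glued from the patches `V_j := U ∩ W_j`
  refine ⟨T₀, hT₀1, exists_differentiableOn_of_local_ae_eq_within _ fun z₀ hz₀ => ?_⟩
  obtain ⟨j, hj⟩ := hcov z₀ hz₀.1
  set V : Set ℂ := U ∩ W j with hVdef
  have hVo : IsOpen V := hUo.inter (hWo j)
  have hz₀V : z₀ ∈ V := ⟨hz₀.1, hj⟩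
  -- the natural payer on `D := V ∩ (U ∖ P)` with the trivial prefactor `ĥ := 1`
  have hEcinv : ∀ z ∈ V ∩ (U \ P), ∀ γ : (quasiSplit (↥(maximalRealSubfield L)) L (IsCMField.complexConj L) 2).arithmeticSubgroup, ∀ x : (quasiSplit (↥(maximalRealSubfield L)) L (IsCMField.complexConj L) 2).Adelic,
      Ec z ((γ : (quasiSplit (↥(maximalRealSubfield L)) L (IsCMField.complexConj L) 2).Adelic) * x) = Ec z x := by
    intro z hz γ x
    rw [hE5 j z hz.1 hz.2.2 ((γ : (quasiSplit (↥(maximalRealSubfield L)) L (IsCMField.complexConj L) 2).Adelic) * x), hE5 j z hz.1 hz.2.2 x]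
    refine integral_congr_ae (Eventually.of_forall fun y => ?_)
    show h j y * _ = h j y * _
    rw [mul_assoc, lift_quotientSubgroup_mul ((s j z : HX (↥(maximalRealSubfield L)) L (IsCMField.complexConj L) 2 (n + 3) μ) : (quasiSplit (↥(maximalRealSubfield L)) L (IsCMField.complexConj L) 2).automorphicQuotient → ℂ)
      (γ : (quasiSplit (↥(maximalRealSubfield L)) L (IsCMField.complexConj L) 2).Adelic) ((quasiSplit (↥(maximalRealSubfield L)) L (IsCMField.complexConj L) 2).arithmeticSubgroup_le_quotientSubgroup γ.2) (x * y)]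
  have hrepr : ∀ z ∈ V ∩ (U \ P), ∀ g : (quasiSplit (↥(maximalRealSubfield L)) L (IsCMField.complexConj L) 2).Adelic,
      Ec z g = ((fun _ : ℂ => (1 : ℂ)) z)⁻¹ * ∫ y, h j y * ((s j z : HX (↥(maximalRealSubfield L)) L (IsCMField.complexConj L) 2 (n + 3) μ) : (quasiSplit (↥(maximalRealSubfield L)) L (IsCMField.complexConj L) 2).automorphicQuotient → ℂ)
        ((quasiSplit (↥(maximalRealSubfield L)) L (IsCMField.complexConj L) 2).toAutomorphicQuotient (g * y)⁻¹) ∂νG := by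
    intro z hz g
    rw [inv_one, one_mul]
    exact hE5 j z hz.1 hz.2.2 g
  obtain ⟨Fam, hFd, hFam⟩ := exists_family_of_operator_letters' ν h𝓕N hT₀1 (n + 3) μ νG (h j) (D := V ∩ (U \ P)) (s j) ((hs j).mono fun z hz => hz.1)
    (fun _ : ℂ => (1 : ℂ)) (differentiableOn_const (1 : ℂ)) (fun _ _ => one_ne_zero) Ec hEcinv hrepr (T j) (hTX j) A hA (K j) (hKspec j)
  exact ⟨V, hVo.mem_nhds hz₀V, Fam, hFd, hFam⟩

/-! ## §2 The (χ,τ) head: patches `{IsUnit (𝔥_j z)}`, sections `Ψ(z)(𝔥_j(z)⁻¹ φ)` -/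

/-- **CLOSER₂ FOR A SECTION `φ ∈ V` OF A `(χ,τ)`-SECTION SPACE — THE `L²(𝔛, μ)`-HOLOMORPHIC FAMILY OF TRUNCATED CONTINUED EISENSTEIN SERIES `z ↦ [Λ^{T₀} Ẽ(φ, z)]` OF `U(1,1)_{L∕L⁺}` ON
`U ∖ P`** (module docstring).  Structural letters and the per-ball objects `η, h = S_η η, a, κ, T, U` with their clauses as ★ `exists_truncatedFamily_cm_two`; the (χ,τ) currency:
a subspace `V` of functions on `G(𝔸)` (★ `chiSectionSpace χ K′ ω`), the section `φ ∈ V`, the Hecke matrices `𝔥_j : ℂ → Module.End ℂ V` (★ `exists_heckeEnd_cm`), the linear unknown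
`Ψ(z) : V →ₗ 𝔛` (ruling (119)); the cover `∀ z ∈ D_n, ∃ j, IsUnit (𝔥_j z)`, the openness of `{z | IsUnit (𝔥_j z)}` and the holomorphy of `z ↦ Ψ(z)(Ring.inverse (𝔥_j z) φ)` on
`U ∩ {IsUnit (𝔥_j z)}` (finite-dimensional linear algebra, companion file), and (E5) `Ẽ(φ, z)(g) = ∫ h_j(y)·Ψ(z)(𝔥_j(z)⁻¹φ)[(g y)⁻¹] dν_G(y)` for `z ∈ U ∖ P` with `𝔥_j(z)` invertible
(★ X2_χ).  THEN `∃ T₀ ≥ 1, ∃ Fam, DifferentiableOn ℂ Fam (U ∖ P) ∧ ∀ z ∈ U ∖ P, Fam z =ᵐ[μ] quotFun (Λ^{T₀} (Ec z))`.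
[cite: BernsteinLapid2019, Thm 2.3, §4 Claim 1 (p. 9) and Claims 4–5 (p. 10)] [cite: MoeglinWaldspurger1995, I.2.17, II.1.7, IV.2.3] -/
theorem exists_truncatedFamily_chi_cm_two
    -- structural letters: the measures (as ★ X1 ∕ ★ CLOSER₂)
    (μ : Measure (quasiSplit (↥(maximalRealSubfield L)) L (IsCMField.complexConj L) 2).automorphicQuotient) [(quasiSplit (↥(maximalRealSubfield L)) L (IsCMField.complexConj L) 2).IsAutomorphicMeasure μ]
    (νG : Measure (quasiSplit (↥(maximalRealSubfield L)) L (IsCMField.complexConj L) 2).Adelic) [νG.IsHaarMeasure] [νG.IsInvInvariant] [SFinite νG]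
    (ν : Measure ↥(adelicUnipotent (↥(maximalRealSubfield L)) L (IsCMField.complexConj L) 2)) [ν.IsHaarMeasure] [ν.IsMulRightInvariant] [ν.IsInvInvariant]
    {𝓕 : Set ↥(adelicUnipotent (↥(maximalRealSubfield L)) L (IsCMField.complexConj L) 2)}
    (h𝓕N : IsFundamentalDomain ↥(rationalUnipotent (↥(maximalRealSubfield L)) L (IsCMField.complexConj L) 2) 𝓕 ν) (h𝓕c : IsCompact (closure 𝓕)) (h𝓕₀ : ν 𝓕 ≠ 0)
    {β : (quasiSplit (↥(maximalRealSubfield L)) L (IsCMField.complexConj L) 2).Adelic → ℝ≥0∞}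
    (hβ : IsCoveringWeight ↥((arithmeticBorel (↥(maximalRealSubfield L)) L (IsCMField.complexConj L) 2).map (quasiSplit (↥(maximalRealSubfield L)) L (IsCMField.complexConj L) 2).arithmeticSubgroup.subtype) β)
    {μZ : Measure (borelQuotient (↥(maximalRealSubfield L)) L (IsCMField.complexConj L) 2)} [SFinite μZ]
    (hμZ : ∀ f : borelQuotient (↥(maximalRealSubfield L)) L (IsCMField.complexConj L) 2 → ℝ≥0∞, Measurable f → ∫⁻ z, f z ∂μZ = ∫⁻ g, β g * f (toBorelQuotient (↥(maximalRealSubfield L)) L (IsCMField.complexConj L) 2 g) ∂νG)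
    -- per-ball objects (ball `D_n = ball 0 (n+2)`, weight `k = n + 3`)
    (n : ℕ) {I : Type} [Fintype I] (η : I → GL (Fin 2) (AdeleRing (𝓞 L) L) → ℝ) (h : I → (quasiSplit (↥(maximalRealSubfield L)) L (IsCMField.complexConj L) 2).Adelic → ℂ) (a : ℝ≥0) (κ : I → ℝ≥0)
    (T : I → HX (↥(maximalRealSubfield L)) L (IsCMField.complexConj L) 2 (n + 3) μ →L[ℂ] HX (↥(maximalRealSubfield L)) L (IsCMField.complexConj L) 2 (n + 3) μ) (U : Set ℂ)
    -- the (χ,τ) currency: the section space, the section, the Hecke matrices, the linear unknown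
    (V : Submodule ℂ ((quasiSplit (↥(maximalRealSubfield L)) L (IsCMField.complexConj L) 2).Adelic → ℂ)) (φ : ↥V) (𝔥 : I → ℂ → Module.End ℂ ↥V)
    (Ψ : ℂ → (↥V →ₗ[ℂ] HX (↥(maximalRealSubfield L)) L (IsCMField.complexConj L) 2 (n + 3) μ))
    -- clauses (only those used)
    (hη : ∀ i, IsTestFunctionGL 2 L (η i))
    (hdef : ∀ i, h i = fun y : (quasiSplit (↥(maximalRealSubfield L)) L (IsCMField.complexConj L) 2).Adelic => orbitalSmoothing νG (fun x : (quasiSplit (↥(maximalRealSubfield L)) L (IsCMField.complexConj L) 2).Adelic => ((η i (adelicVal (↥(maximalRealSubfield L)) L (IsCMField.complexConj L) 2 ((StdForm.antidiagonal 2).over L) x) : ℝ) : ℂ)) (fun x : (quasiSplit (↥(maximalRealSubfield L)) L (IsCMField.complexConj L) 2).Adelic => ((η i (adelicVal (↥(maximalRealSubfield L)) L (IsCMField.complexConj L) 2 ((StdForm.antidiagonal 2).over L) x) : ℝ) : ℂ)) y)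
    (hreg : ∀ i, Continuous (h i) ∧ HasCompactSupport (h i))
    (hcov : ∀ z ∈ Metric.ball (0 : ℂ) (n + 2), ∃ i, IsUnit (𝔥 i z))
    (ha : 0 < a) (hκ : ∀ i, 1 ≤ κ i)
    (hΩ : ∀ i, ∀ z : borelQuotient (↥(maximalRealSubfield L)) L (IsCMField.complexConj L) 2, ∀ y ∈ tsupport (h i), borelQuotHeight (↥(maximalRealSubfield L)) L (IsCMField.complexConj L) 2 z ≤ κ i * borelQuotHeight (↥(maximalRealSubfield L)) L (IsCMField.complexConj L) 2 (rightShift (↥(maximalRealSubfield L)) L (IsCMField.complexConj L) 2 y z))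
    (hTX : ∀ i, ∀ u : HX (↥(maximalRealSubfield L)) L (IsCMField.complexConj L) 2 (n + 3) μ, (T i u : (quasiSplit (↥(maximalRealSubfield L)) L (IsCMField.complexConj L) 2).automorphicQuotient → ℂ) =ᵐ[μ.withDensity fun x => (((supHeight (↥(maximalRealSubfield L)) L (IsCMField.complexConj L) 2 x)⁻¹ ^ (2 * (n + 3)) : ℝ≥0) : ℝ≥0∞)]
      fun ξ => ∫ y, h i y * (u : (quasiSplit (↥(maximalRealSubfield L)) L (IsCMField.complexConj L) 2).automorphicQuotient → ℂ) (y⁻¹ • ξ) ∂νG)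
    (hUo : IsOpen U) (hUD : U ⊆ Metric.ball (0 : ℂ) (n + 2))
    (h𝔥o : ∀ i, IsOpen {z : ℂ | IsUnit (𝔥 i z)})
    (hΨ : ∀ i, DifferentiableOn ℂ (fun z : ℂ => Ψ z (Ring.inverse (𝔥 i z) φ)) (U ∩ {z : ℂ | IsUnit (𝔥 i z)}))
    -- the global continued function, the exceptional set, and the pointwise representation (E5) (★ X2_χ)
    (Ec : ℂ → (quasiSplit (↥(maximalRealSubfield L)) L (IsCMField.complexConj L) 2).Adelic → ℂ) (P : Set ℂ)
    (hE5 : ∀ j, ∀ z ∈ U, z ∉ P → IsUnit (𝔥 j z) → ∀ g : (quasiSplit (↥(maximalRealSubfield L)) L (IsCMField.complexConj L) 2).Adelic,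
      Ec z g = ∫ y, h j y * ((Ψ z (Ring.inverse (𝔥 j z) φ) : HX (↥(maximalRealSubfield L)) L (IsCMField.complexConj L) 2 (n + 3) μ) : (quasiSplit (↥(maximalRealSubfield L)) L (IsCMField.complexConj L) 2).automorphicQuotient → ℂ)
          ((quasiSplit (↥(maximalRealSubfield L)) L (IsCMField.complexConj L) 2).toAutomorphicQuotient (g * y)⁻¹) ∂νG) :
    ∃ T₀ : ℝ≥0, 1 ≤ T₀ ∧ ∃ Fam : ℂ → Lp ℂ 2 μ, DifferentiableOn ℂ Fam (U \ P) ∧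
      ∀ z ∈ U \ P, ((Fam z : Lp ℂ 2 μ) : (quasiSplit (↥(maximalRealSubfield L)) L (IsCMField.complexConj L) 2).automorphicQuotient → ℂ) =ᵐ[μ]
        (quasiSplit (↥(maximalRealSubfield L)) L (IsCMField.complexConj L) 2).quotFun (truncation ν 𝓕 T₀ (Ec z)) :=
  exists_truncatedFamily_cm_two_of_patches L μ νG ν h𝓕N h𝓕c h𝓕₀ hβ hμZ n η h a κ T U (fun i => {z : ℂ | IsUnit (𝔥 i z)})
    (fun i z => Ψ z (Ring.inverse (𝔥 i z) φ)) hη hdef hreg ha hκ hΩ hTX hUo h𝔥o (fun z hz => hcov z (hUD hz)) hΨ Ec P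
    fun j z hz hzP g => hE5 j z hz.1 hzP hz.2 g

/-- **THE (χ,τ) CLOSER ON THE UPPER DOMAIN `D₁ := (D⁺ ∩ D_n ∩ U) ∖ P`, `D⁺ = {½ < Re z, 0 < Im z}`** — the `(F, hFd)` of ★ row 14 FILE 2
`K2E1ChiMaassSelbergContinuedCMTwo.poleControl_continued_chi_cm_two_of_truncatedFamily_on` at `D₁ = ({z | ½ < z.re ∧ 0 < z.im} ∩ ball 0 (n+2) ∩ U) ∖ P` (its `hD₁sub` is automatic),
`hFtube` following from (E1) `Ẽ(φ, z) = E(f_z^φ)` on the tube `1 < Re z`. [cite: BernsteinLapid2019, §4 Claims 4–5 (p. 10)] [cite: MoeglinWaldspurger1995, IV.2.3, IV.3.12 (a)] -/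
theorem exists_truncatedFamily_chi_cm_two_upper
    (μ : Measure (quasiSplit (↥(maximalRealSubfield L)) L (IsCMField.complexConj L) 2).automorphicQuotient) [(quasiSplit (↥(maximalRealSubfield L)) L (IsCMField.complexConj L) 2).IsAutomorphicMeasure μ]
    (νG : Measure (quasiSplit (↥(maximalRealSubfield L)) L (IsCMField.complexConj L) 2).Adelic) [νG.IsHaarMeasure] [νG.IsInvInvariant] [SFinite νG]
    (ν : Measure ↥(adelicUnipotent (↥(maximalRealSubfield L)) L (IsCMField.complexConj L) 2)) [ν.IsHaarMeasure] [ν.IsMulRightInvariant] [ν.IsInvInvariant]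
    {𝓕 : Set ↥(adelicUnipotent (↥(maximalRealSubfield L)) L (IsCMField.complexConj L) 2)}
    (h𝓕N : IsFundamentalDomain ↥(rationalUnipotent (↥(maximalRealSubfield L)) L (IsCMField.complexConj L) 2) 𝓕 ν) (h𝓕c : IsCompact (closure 𝓕)) (h𝓕₀ : ν 𝓕 ≠ 0)
    {β : (quasiSplit (↥(maximalRealSubfield L)) L (IsCMField.complexConj L) 2).Adelic → ℝ≥0∞}
    (hβ : IsCoveringWeight ↥((arithmeticBorel (↥(maximalRealSubfield L)) L (IsCMField.complexConj L) 2).map (quasiSplit (↥(maximalRealSubfield L)) L (IsCMField.complexConj L) 2).arithmeticSubgroup.subtype) β)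
    {μZ : Measure (borelQuotient (↥(maximalRealSubfield L)) L (IsCMField.complexConj L) 2)} [SFinite μZ]
    (hμZ : ∀ f : borelQuotient (↥(maximalRealSubfield L)) L (IsCMField.complexConj L) 2 → ℝ≥0∞, Measurable f → ∫⁻ z, f z ∂μZ = ∫⁻ g, β g * f (toBorelQuotient (↥(maximalRealSubfield L)) L (IsCMField.complexConj L) 2 g) ∂νG)
    (n : ℕ) {I : Type} [Fintype I] (η : I → GL (Fin 2) (AdeleRing (𝓞 L) L) → ℝ) (h : I → (quasiSplit (↥(maximalRealSubfield L)) L (IsCMField.complexConj L) 2).Adelic → ℂ) (a : ℝ≥0) (κ : I → ℝ≥0)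
    (T : I → HX (↥(maximalRealSubfield L)) L (IsCMField.complexConj L) 2 (n + 3) μ →L[ℂ] HX (↥(maximalRealSubfield L)) L (IsCMField.complexConj L) 2 (n + 3) μ) (U : Set ℂ)
    (V : Submodule ℂ ((quasiSplit (↥(maximalRealSubfield L)) L (IsCMField.complexConj L) 2).Adelic → ℂ)) (φ : ↥V) (𝔥 : I → ℂ → Module.End ℂ ↥V)
    (Ψ : ℂ → (↥V →ₗ[ℂ] HX (↥(maximalRealSubfield L)) L (IsCMField.complexConj L) 2 (n + 3) μ))
    (hη : ∀ i, IsTestFunctionGL 2 L (η i))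
    (hdef : ∀ i, h i = fun y : (quasiSplit (↥(maximalRealSubfield L)) L (IsCMField.complexConj L) 2).Adelic => orbitalSmoothing νG (fun x : (quasiSplit (↥(maximalRealSubfield L)) L (IsCMField.complexConj L) 2).Adelic => ((η i (adelicVal (↥(maximalRealSubfield L)) L (IsCMField.complexConj L) 2 ((StdForm.antidiagonal 2).over L) x) : ℝ) : ℂ)) (fun x : (quasiSplit (↥(maximalRealSubfield L)) L (IsCMField.complexConj L) 2).Adelic => ((η i (adelicVal (↥(maximalRealSubfield L)) L (IsCMField.complexConj L) 2 ((StdForm.antidiagonal 2).over L) x) : ℝ) : ℂ)) y)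
    (hreg : ∀ i, Continuous (h i) ∧ HasCompactSupport (h i))
    (hcov : ∀ z ∈ Metric.ball (0 : ℂ) (n + 2), ∃ i, IsUnit (𝔥 i z))
    (ha : 0 < a) (hκ : ∀ i, 1 ≤ κ i)
    (hΩ : ∀ i, ∀ z : borelQuotient (↥(maximalRealSubfield L)) L (IsCMField.complexConj L) 2, ∀ y ∈ tsupport (h i), borelQuotHeight (↥(maximalRealSubfield L)) L (IsCMField.complexConj L) 2 z ≤ κ i * borelQuotHeight (↥(maximalRealSubfield L)) L (IsCMField.complexConj L) 2 (rightShift (↥(maximalRealSubfield L)) L (IsCMField.complexConj L) 2 y z))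
    (hTX : ∀ i, ∀ u : HX (↥(maximalRealSubfield L)) L (IsCMField.complexConj L) 2 (n + 3) μ, (T i u : (quasiSplit (↥(maximalRealSubfield L)) L (IsCMField.complexConj L) 2).automorphicQuotient → ℂ) =ᵐ[μ.withDensity fun x => (((supHeight (↥(maximalRealSubfield L)) L (IsCMField.complexConj L) 2 x)⁻¹ ^ (2 * (n + 3)) : ℝ≥0) : ℝ≥0∞)]
      fun ξ => ∫ y, h i y * (u : (quasiSplit (↥(maximalRealSubfield L)) L (IsCMField.complexConj L) 2).automorphicQuotient → ℂ) (y⁻¹ • ξ) ∂νG)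
    (hUo : IsOpen U) (hUD : U ⊆ Metric.ball (0 : ℂ) (n + 2))
    (h𝔥o : ∀ i, IsOpen {z : ℂ | IsUnit (𝔥 i z)})
    (hΨ : ∀ i, DifferentiableOn ℂ (fun z : ℂ => Ψ z (Ring.inverse (𝔥 i z) φ)) (U ∩ {z : ℂ | IsUnit (𝔥 i z)}))
    (Ec : ℂ → (quasiSplit (↥(maximalRealSubfield L)) L (IsCMField.complexConj L) 2).Adelic → ℂ) (P : Set ℂ)
    (hE5 : ∀ j, ∀ z ∈ U, z ∉ P → IsUnit (𝔥 j z) → ∀ g : (quasiSplit (↥(maximalRealSubfield L)) L (IsCMField.complexConj L) 2).Adelic,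
      Ec z g = ∫ y, h j y * ((Ψ z (Ring.inverse (𝔥 j z) φ) : HX (↥(maximalRealSubfield L)) L (IsCMField.complexConj L) 2 (n + 3) μ) : (quasiSplit (↥(maximalRealSubfield L)) L (IsCMField.complexConj L) 2).automorphicQuotient → ℂ)
          ((quasiSplit (↥(maximalRealSubfield L)) L (IsCMField.complexConj L) 2).toAutomorphicQuotient (g * y)⁻¹) ∂νG) :
    ∃ T₀ : ℝ≥0, 1 ≤ T₀ ∧ ∃ Fam : ℂ → Lp ℂ 2 μ, DifferentiableOn ℂ Fam (({z : ℂ | 1 / 2 < z.re ∧ 0 < z.im} ∩ Metric.ball (0 : ℂ) (n + 2) ∩ U) \ P) ∧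
      ∀ z ∈ ({z : ℂ | 1 / 2 < z.re ∧ 0 < z.im} ∩ Metric.ball (0 : ℂ) (n + 2) ∩ U) \ P,
        ((Fam z : Lp ℂ 2 μ) : (quasiSplit (↥(maximalRealSubfield L)) L (IsCMField.complexConj L) 2).automorphicQuotient → ℂ) =ᵐ[μ]
          (quasiSplit (↥(maximalRealSubfield L)) L (IsCMField.complexConj L) 2).quotFun (truncation ν 𝓕 T₀ (Ec z)) := by
  obtain ⟨T₀, hT₀, Fam, hFd, hFam⟩ := exists_truncatedFamily_chi_cm_two L μ νG ν h𝓕N h𝓕c h𝓕₀ hβ hμZ n η h a κ T U V φ 𝔥 Ψ hη hdef hreg hcov ha hκ hΩ hTX hUo hUD h𝔥o hΨ Ec P hE5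
  have hsub : ({z : ℂ | 1 / 2 < z.re ∧ 0 < z.im} ∩ Metric.ball (0 : ℂ) (n + 2) ∩ U) \ P ⊆ U \ P := fun z hz => ⟨hz.1.2, hz.2⟩
  exact ⟨T₀, hT₀, Fam, hFd.mono hsub, fun z hz => hFam z (hsub hz)⟩

end Closer

end Summit.HodgeConjecture.HodgeConjecture.Cruxes.H413.K2E1ChiMaassSelbergFamilyCMTwo

end
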